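import Summits.Ventures.CertifiedManyBodySolver.Observables.SourcedGibbsTrialCapKSpaceSymbol
import HarnessLib

/-!
# The HF–BCS sourced cap in momentum space (XII): resolution of the identity in plane waves on the fermionic torus
# (entries of ANY one-body / Nambu matrix from its action on plane waves)

HONEST FRAMING: zero compute; a PROVED identity of finite-dimensional linear algebra; no number is claimed. This is the
replacement, for the antiferromagnetic + `d`-wave-pinned chain (files (VIII)–(XI)), of the paramagnetic chain's
translation-invariant inversion `FermionTorusPlaneWaveInversion.inv_apply_eq_sum_torusChar` (which assumes a `2 × 2`
symbol per momentum): the staggered field couples `p` with `p + Q`, so instead of inverting a symbol we read the entries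
of the Fermi matrix `F = (1 + e^{β𝓗})⁻¹` directly off its action on plane waves (files (X)–(XI)) through the character
orthogonality `Σ_k χ_k(z − y) = L^d [z = y]`. Not a statement about order; not a superconductivity verdict.

Cell `hubbard-obs` (D-0042 / D-0082), seat `hubbard-obs-pin-2` (`prover-hubbard-obs-pin-2-g7-0`).

* `mulVec_planeWave_apply` — `(F χ_k⊗e_τ)(x,σ) = Σ_z F((x,σ),(z,τ)) χ_k(z)`.
* `apply_orb_eq_sum_mulVec_planeWave` — **`F((x,σ),(y,τ)) = L^{-d} Σ_k χ_k(−y) · (F χ_k⊗e_τ)(x,σ)`** for every matrix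
  `F` on the orbitals of the fermionic torus (resolution of the identity `e_{(y,τ)} = L^{-d} Σ_k χ_k(−y) χ_k ⊗ e_τ`).

References: S. Friedli, Y. Velenik, *Statistical Mechanics of Lattice Systems* (2017) §10.4 (characters of the discrete
torus) [FriedliVelenik2017]; Bach–Lieb–Solovej, J. Stat. Phys. 76 (1994) 3, §2 [BachLiebSolovej1994].
-/

noncomputable section

open Matrix Finset Literature.MathematicalPhysics.QuantumLattice Literature.Probability.LatticeModels
open scoped ComplexConjugate

namespace Summit.Ventures.CertifiedManyBodySolver.Observables

section Resolution

variable {d L : ℕ} [NeZero L]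

/-- The action of a matrix on a plane wave, in coordinates: `(F χ_k⊗e_τ)(x,σ) = Σ_z F((x,σ),(z,τ)) χ_k(z)`. [folklore] -/
theorem mulVec_planeWave_apply (F : Matrix (Orb (FermionTorus d L)) (Orb (FermionTorus d L)) ℂ)
    (k : TorusSite d L) (τ : Fin 2) (a : Orb (FermionTorus d L)) :
    (F *ᵥ planeWave k τ) a = ∑ z : FermionTorus d L, F a (orb z τ) * torusChar k z.toTorusSite := by
  rw [Matrix.mulVec, dotProduct, sum_orb_eq_sum_sum]
  refine Finset.sum_congr rfl fun z _ => ?_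
  rw [Fin.sum_univ_two, planeWave_orb, planeWave_orb]
  fin_cases τ <;> simp

/-- **Resolution of the identity in plane waves.** For EVERY matrix `F` on the orbitals of the fermionic torus,
`F((x,σ),(y,τ)) = L^{-d} Σ_k χ_k(−y) (F χ_k⊗e_τ)(x,σ)` (`Σ_k χ_k(z − y) = L^d [z = y]`). The entries of the Fermi matrix of
the spin-density-wave + BCS trial state follow from its plane-wave action (files (X)–(XI)) by this identity.
[cite: FriedliVelenik2017, §10.4] -/
theorem apply_orb_eq_sum_mulVec_planeWave (F : Matrix (Orb (FermionTorus d L)) (Orb (FermionTorus d L)) ℂ)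
    (a : Orb (FermionTorus d L)) (y : FermionTorus d L) (τ : Fin 2) :
    F a (orb y τ) = ((L : ℂ) ^ d)⁻¹ *
      ∑ k : TorusSite d L, torusChar k (-y.toTorusSite) * (F *ᵥ planeWave k τ) a := by
  have hL : (L : ℂ) ^ d ≠ 0 := natCast_pow_ne_zero
  have inner : ∀ z : FermionTorus d L,
      ∑ k : TorusSite d L, torusChar k (-y.toTorusSite) * (F a (orb z τ) * torusChar k z.toTorusSite) =
        F a (orb z τ) * (if z.toTorusSite - y.toTorusSite = 0 then (L : ℂ) ^ d else 0) := by
    intro z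
    rw [← sum_torusChar_left, Finset.mul_sum]
    refine Finset.sum_congr rfl fun k _ => ?_
    rw [sub_eq_add_neg, torusChar_add_right]
    ring
  have hsite : ∀ z : FermionTorus d L, (z.toTorusSite - y.toTorusSite = 0) ↔ z = y := fun z => by
    rw [sub_eq_zero]; exact FermionTorus.equivTorusSite.apply_eq_iff_eq
  have key : ∑ k : TorusSite d L, torusChar k (-y.toTorusSite) * (F *ᵥ planeWave k τ) a =
      (L : ℂ) ^ d * F a (orb y τ) := by
    simp_rw [mulVec_planeWave_apply, Finset.mul_sum]
    rw [Finset.sum_comm, Finset.sum_congr rfl fun z _ => inner z]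
    simp_rw [hsite]
    simp only [mul_ite, mul_zero, Finset.sum_ite_eq', Finset.mem_univ, if_true]
    ring
  rw [key, ← mul_assoc, inv_mul_cancel₀ hL, one_mul]

end Resolution

end Summit.Ventures.CertifiedManyBodySolver.Observables

end
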